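import Summits.KontsevichZagierPeriods.KontsevichZagierPeriods.Theses.HurwitzMicroSectors
import Summits.KontsevichZagierPeriods.KontsevichZagierPeriods.Theorems.HurwitzMicroSectorsNormalFormPrinciplePiBoxTransfer
import Summits.KontsevichZagierPeriods.KontsevichZagierPeriods.Theorems.HurwitzMicroSectorsNormalFormPrincipleVariants2238
import Summits.KontsevichZagierPeriods.KontsevichZagierPeriods.Theorems.HurwitzMicroSectorsNormalFormPrincipleVariants2319

/-! TTRL-lite variant V2328 of stmt-KontsevichZagierPeriods-3869

Variant V2328 = `stub_boxRigidity` (the leaf `BoxRigidity` of `NormalFormPrinciple`: two representations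
on open unit boxes with integrands of KZ's rational shape `p/q` over `ℚ` and equal values are
KZ-equivalent) with BOTH dimensions frozen, `fix m := 8; fix m' := 5`. Verdict of the attempt seat:
**open** — this file is the exact-strength certificate, not a proof of the variant. With
`BoxVanishing K` := "a box-rational representation of dimension `K` and value `0` is a relation", the
tree's graded lemmas (`boxVanishingDim_left_of_pair`, `boxRigidityLe_of_boxVanishingDim`,
`boxVanishingDim_mono`, file `…Variants2238`) pin the variant exactly:
`V2328 ⟺ BoxVanishing 8 ⟺ BoxRigidity for all m, m' ≤ 8 ⟺ V2319` (`fix m := 8; fix m' := 2`): for (⇒)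
compare a vanishing box-rational `N` on `(0,1)⁸` with the zero integrand on `(0,1)⁵` (box-rational, value
`0`, itself a relation), for (⇐) pad both representations to `(0,1)⁸` and subtract there (`5 ≤ 8`); the
frozen right dimension `5` is idle. `BoxVanishing 8` contains, e.g., "for `a b : ℚ`,
`a + b·ζ(5) = 0 ⇒ [a + b/(1 − x₁⋯x₅)]` (padded to `(0,1)⁸`) is a relation" — decidable today only through
the open irrationality of `ζ(5)` — and already its dimension-`2` shadow (all `ℚ`-relations among
`π²`, `log a · log b`, Catalan's `G`, `Li₂` at rationals realised by the four moves) is open; the proved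
frontier is `max m m' ≤ 1` (`boxRigidity_of_le_one`, Baker). Conversely `KontsevichZagierPeriods → V2328`
(`stub_boxRigidity_var2328_of_statement`), so a refutation of the variant would refute the Summit, and
the tree has no invariant of `KZ.relations` finer than `KZ.eval`. Source: M. Kontsevich, D. Zagier,
*Periods* (2001), §1.2 Conjecture 1. Pure proof file, no definitions. -/

-- `Summit.<Summit>.<Problem>` is the tree's mandated summit-side namespace (CONVENTIONS §2); for this
-- single-conjunct summit the two coincide, so the duplicate is deliberate.
set_option linter.dupNamespace false

noncomputable section

namespace Summit.KontsevichZagierPeriods.KontsevichZagierPeriods.Theorems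

open MeasureTheory Set
open Literature.NumberTheory.Transcendental Literature.NumberTheory.Transcendental.KZ
open Summit.KontsevichZagierPeriods.KontsevichZagierPeriods.Theses.HurwitzMicroSectors
open Summit.KontsevichZagierPeriods.HurwitzMicroSectors.NormalFormPrinciple.PiBox

/-- **V2328 ⟺ `BoxVanishing 8`**: (⇒) `boxVanishingDim_left_of_pair 8 5` (compare a vanishing
box-rational representation on `(0,1)⁸` with the zero integrand on `(0,1)⁵`);
(⇐) `boxRigidityLe_of_boxVanishingDim 8` with `m = 8`, `m' = 5 ≤ 8`.
[cite: KontsevichZagier2001, §1.2 Conjecture 1] -/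
theorem stub_boxRigidity_var2328_iff_boxVanishing_eight :
    (∀ (N : IntegralRep 8) (N' : IntegralRep 5), N.domain = {x | ∀ i, x i ∈ Set.Ioo (0:ℝ) 1} → N.IsRational → N'.domain = {x | ∀ i, x i ∈ Set.Ioo (0:ℝ) 1} → N'.IsRational → N.value = N'.value → Equivalent N N') ↔
    (∀ (M : IntegralRep 8), M.domain = {x | ∀ i, x i ∈ Set.Ioo (0:ℝ) 1} → M.IsRational →
      M.value = 0 → of M ∈ relations) :=
  ⟨fun h => boxVanishingDim_left_of_pair 8 5 h,
    fun hvan N N' => boxRigidityLe_of_boxVanishingDim 8 hvan 8 5 N N' le_rfl (by norm_num)⟩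

/-- **V2328 ⟺ `BoxRigidity` for all `m, m' ≤ 8`** (the honest strength of the variant: Conjecture 1 for
all pairs of rational integrands on the open unit boxes of dimension at most `8`).
[cite: KontsevichZagier2001, §1.2 Conjecture 1] -/
theorem stub_boxRigidity_var2328_iff_le_eight :
    (∀ (N : IntegralRep 8) (N' : IntegralRep 5), N.domain = {x | ∀ i, x i ∈ Set.Ioo (0:ℝ) 1} → N.IsRational → N'.domain = {x | ∀ i, x i ∈ Set.Ioo (0:ℝ) 1} → N'.IsRational → N.value = N'.value → Equivalent N N') ↔
    (∀ (m m' : ℕ) (N : IntegralRep m) (N' : IntegralRep m'), m ≤ 8 → m' ≤ 8 →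
      N.domain = {x | ∀ i, x i ∈ Set.Ioo (0:ℝ) 1} → N.IsRational →
      N'.domain = {x | ∀ i, x i ∈ Set.Ioo (0:ℝ) 1} → N'.IsRational →
      N.value = N'.value → Equivalent N N') :=
  ⟨fun h => boxRigidityLe_of_boxVanishingDim 8 (stub_boxRigidity_var2328_iff_boxVanishing_eight.1 h),
    fun h N N' => h 8 5 N N' le_rfl (by norm_num)⟩

/-- **V2328 ⟺ the sibling V2319** (`fix m := 8; fix m' := 2`): both are `BoxVanishing 8`
(`stub_boxRigidity_var2319_iff_boxVanishing_eight`) — the frozen right dimension is idle.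
[cite: KontsevichZagier2001, §1.2 Conjecture 1] -/
theorem stub_boxRigidity_var2328_iff_var2319 :
    (∀ (N : IntegralRep 8) (N' : IntegralRep 5), N.domain = {x | ∀ i, x i ∈ Set.Ioo (0:ℝ) 1} → N.IsRational → N'.domain = {x | ∀ i, x i ∈ Set.Ioo (0:ℝ) 1} → N'.IsRational → N.value = N'.value → Equivalent N N') ↔
    (∀ (N : IntegralRep 8) (N' : IntegralRep 2), N.domain = {x | ∀ i, x i ∈ Set.Ioo (0:ℝ) 1} →
      N.IsRational → N'.domain = {x | ∀ i, x i ∈ Set.Ioo (0:ℝ) 1} → N'.IsRational →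
      N.value = N'.value → Equivalent N N') := by
  rw [stub_boxRigidity_var2328_iff_boxVanishing_eight, stub_boxRigidity_var2319_iff_boxVanishing_eight]

/-- **V2328 is the same statement as the swapped pair `(5, 8)`** (symmetry of `Equivalent`).
[cite: KontsevichZagier2001, §1.2 Conjecture 1] -/
theorem stub_boxRigidity_var2328_iff_swap :
    (∀ (N : IntegralRep 8) (N' : IntegralRep 5), N.domain = {x | ∀ i, x i ∈ Set.Ioo (0:ℝ) 1} → N.IsRational → N'.domain = {x | ∀ i, x i ∈ Set.Ioo (0:ℝ) 1} → N'.IsRational → N.value = N'.value → Equivalent N N') ↔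
    (∀ (N : IntegralRep 5) (N' : IntegralRep 8), N.domain = {x | ∀ i, x i ∈ Set.Ioo (0:ℝ) 1} →
      N.IsRational → N'.domain = {x | ∀ i, x i ∈ Set.Ioo (0:ℝ) 1} → N'.IsRational →
      N.value = N'.value → Equivalent N N') := by
  constructor <;> intro h N N' hNd hNr hN'd hN'r hv <;> exact (h N' N hN'd hN'r hNd hNr hv.symm).symm

/-- **`BoxVanishing 8` alone already proves V2328** (the residual of the variant, stated as the
missing lemma). [cite: KontsevichZagier2001, §1.2 Conjecture 1] -/
theorem stub_boxRigidity_var2328_of_boxVanishing_eight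
    (hvan : ∀ (M : IntegralRep 8), M.domain = {x | ∀ i, x i ∈ Set.Ioo (0:ℝ) 1} → M.IsRational →
      M.value = 0 → of M ∈ relations) :
    ∀ (N : IntegralRep 8) (N' : IntegralRep 5), N.domain = {x | ∀ i, x i ∈ Set.Ioo (0:ℝ) 1} → N.IsRational → N'.domain = {x | ∀ i, x i ∈ Set.Ioo (0:ℝ) 1} → N'.IsRational → N.value = N'.value → Equivalent N N' :=
  stub_boxRigidity_var2328_iff_boxVanishing_eight.2 hvan

/-- **V2328 ⇒ `BoxVanishing` in every dimension `≤ 8`** (monotonicity `boxVanishingDim_mono`), in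
particular the dimension-`5` statement about vanishing `ℚ`-combinations `a + b·ζ(5) + …` and the
dimension-`2` one containing Catalan's constant. [cite: KontsevichZagier2001, §1.2 Conjecture 1] -/
theorem boxVanishing_le_eight_of_stub_boxRigidity_var2328
    (h : ∀ (N : IntegralRep 8) (N' : IntegralRep 5), N.domain = {x | ∀ i, x i ∈ Set.Ioo (0:ℝ) 1} → N.IsRational → N'.domain = {x | ∀ i, x i ∈ Set.Ioo (0:ℝ) 1} → N'.IsRational → N.value = N'.value → Equivalent N N')
    {j : ℕ} (hj : j ≤ 8) :
    ∀ (M : IntegralRep j), M.domain = {x | ∀ i, x i ∈ Set.Ioo (0:ℝ) 1} → M.IsRational →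
      M.value = 0 → of M ∈ relations :=
  boxVanishingDim_mono hj (stub_boxRigidity_var2328_iff_boxVanishing_eight.1 h)

/-- **The parent leaf ⇒ V2328** (specialisation `m := 8`, `m' := 5`).
[cite: KontsevichZagier2001, §1.2 Conjecture 1] -/
theorem stub_boxRigidity_var2328_of_parent
    (h : ∀ (m m' : ℕ) (N : IntegralRep m) (N' : IntegralRep m'), N.domain = {x | ∀ i, x i ∈ Set.Ioo (0:ℝ) 1} → N.IsRational → N'.domain = {x | ∀ i, x i ∈ Set.Ioo (0:ℝ) 1} → N'.IsRational → N.value = N'.value → Equivalent N N') :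
    ∀ (N : IntegralRep 8) (N' : IntegralRep 5), N.domain = {x | ∀ i, x i ∈ Set.Ioo (0:ℝ) 1} → N.IsRational → N'.domain = {x | ∀ i, x i ∈ Set.Ioo (0:ℝ) 1} → N'.IsRational → N.value = N'.value → Equivalent N N' :=
  h 8 5

/-- **`KontsevichZagierPeriods ⇒ V2328`**: the variant is a special case of Conjecture 1 for the
tree's calculus (`leaves_of_statement`) — so a refutation of the variant would refute the Summit.
[cite: KontsevichZagier2001, §1.2 Conjecture 1] -/
theorem stub_boxRigidity_var2328_of_statement (h : _root_.KontsevichZagierPeriods) :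
    ∀ (N : IntegralRep 8) (N' : IntegralRep 5), N.domain = {x | ∀ i, x i ∈ Set.Ioo (0:ℝ) 1} → N.IsRational → N'.domain = {x | ∀ i, x i ∈ Set.Ioo (0:ℝ) 1} → N'.IsRational → N.value = N'.value → Equivalent N N' :=
  stub_boxRigidity_var2328_of_parent (leaves_of_statement h).1

/-- **Summit ⟺ V2328 ∧ BoxRigidity above dimension 8 ∧ PiCancellation** is NOT claimed; what the tree
gives is the one-way placement `KontsevichZagierPeriods ⇒ BoxRigidity ⇒ V2328 ⇒ BoxVanishing (≤ 8)`,
recorded here as the chain's last computable link: V2328 and `PiCancellation` together still fall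
short of the Summit only by `BoxVanishing` in dimensions `> 8`. This lemma is the formal half:
`BoxRigidity ⇒ V2328 ∧ (∀ K, BoxVanishing K)`. [cite: KontsevichZagier2001, §1.2 Conjecture 1] -/
theorem stub_boxRigidity_var2328_and_boxVanishing_of_parent
    (h : ∀ (m m' : ℕ) (N : IntegralRep m) (N' : IntegralRep m'), N.domain = {x | ∀ i, x i ∈ Set.Ioo (0:ℝ) 1} → N.IsRational → N'.domain = {x | ∀ i, x i ∈ Set.Ioo (0:ℝ) 1} → N'.IsRational → N.value = N'.value → Equivalent N N') :
    (∀ (N : IntegralRep 8) (N' : IntegralRep 5), N.domain = {x | ∀ i, x i ∈ Set.Ioo (0:ℝ) 1} → N.IsRational → N'.domain = {x | ∀ i, x i ∈ Set.Ioo (0:ℝ) 1} → N'.IsRational → N.value = N'.value → Equivalent N N') ∧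
    (∀ (K : ℕ) (M : IntegralRep K), M.domain = {x | ∀ i, x i ∈ Set.Ioo (0:ℝ) 1} → M.IsRational →
      M.value = 0 → of M ∈ relations) :=
  ⟨h 8 5, fun _ M hMd hMr hv => boxVanishing_of_boxRigidity h M hMd hMr hv⟩

end Summit.KontsevichZagierPeriods.KontsevichZagierPeriods.Theorems

end
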